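import Mathlib
import Literature.Geometry.Symplectic.JHolomorphicMap
import Summits.SmoothPoincare4.SmoothPoincare4.Theorems.SullivanDualTameOrBrodyR4PencilDefs
import Summits.SmoothPoincare4.SmoothPoincare4.Theorems.SullivanDualTameOrBrodyR4HelperContinuityOfUniqueness
import Summits.SmoothPoincare4.SmoothPoincare4.Theorems.SullivanDualTameOrBrodyR4HelperFarMemberFlat
import Summits.SmoothPoincare4.SmoothPoincare4.Theorems.SullivanDualTameOrBrodyR4HelperClosedOrBlowupConv
import Summits.SmoothPoincare4.SmoothPoincare4.Theorems.SullivanDualTameOrBrodyR4HelperUniqueOfLocalUnique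

/-!
# The continuity method from a local family WITH local uniqueness (crux `TameOrBrodyR4`, stmt-SmoothPoincare4-7826, line `Sketch`, skeleton v17 — reshape #4, lead prover file)

Route `SullivanDual`, crux `Summit.SmoothPoincare4.SmoothPoincare4.Theses.SullivanDual.TameOrBrodyR4`.
The deep input "two normalised members with the same asymptotic value coincide" (classically:
positivity of intersections at the point at infinity with `A·A = 0` in `S² × S²`) is REMOVED from the
line: once the local family through a member comes with LOCAL UNIQUENESS (the implicit-function
theorem package — the reshaped deep stub `stub_localFamilyUnique` of skeleton v17), global
uniqueness is soft:

* far members are FLAT (`helper_farMemberFlat`, p132261: every intersection of a member with a far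
  flat plane `{Q = t}`, `|t| > R`, lies in the standard region where `Q ∘ u` is holomorphic; a
  generalised argument principle and the deformation `t → ∞` show that `Q ∘ u` omits every far
  value `t ≠ b₀`, hence is constant by connectedness, and `u` is flat by Liouville);
* the set of asymptotic values carrying at most one member is CLOPEN (`helper_uniqueOfLocalUnique`,
  p131899: closed by continuity of local families in the parameter, open by compactness with
  convergence `helper_closedOrBlowupConv` p131769 + the local uniqueness clause) and contains the
  far values, hence is `ℂ`.

`helper_continuityOfLocalUnique` (registered) then runs the landed continuity method
`helper_continuityOfUniqueness` (p129156).

References: M. Gromov, Invent. Math. 82 (1985), §2.4.A; H. Hofer, V. Lizan, J.-C. Sikorav,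
J. Geom. Anal. 7 (1997), Thm 1; C. Wendl, LNM 2216 (2018), Thm 2.44–2.46; D. McDuff, D. Salamon,
*J-holomorphic curves and symplectic topology* (2012), Thm 3.1.5, §3.3.
-/

-- the registered namespace `Summit.SmoothPoincare4.SmoothPoincare4.…` repeats a component
set_option linter.dupNamespace false

noncomputable section

open scoped ContDiff Topology
open Filter Set Metric Literature.Geometry.Symplectic

namespace Summit.SmoothPoincare4.SmoothPoincare4.Cruxes.TameOrBrodyR4.Sketch

/-- Local notation for the model space `ℝ⁴ = EuclideanSpace ℝ (Fin 4)`. -/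
local notation "E4" => EuclideanSpace ℝ (Fin 4)

/-- **Registered helper `helper_continuityOfLocalUnique` (reshape #4): the continuity method from
a local family with local uniqueness and embedded limits.** Same conclusion as `stub_continuity` /
`helper_continuityOfUniqueness` (the complete pencil of the frame `(P, Q)` as a `C^∞` bijective
evaluation map with bijective differential and flat far members — or blow-up data), but the
uniqueness of members is no longer a hypothesis: it is derived from the local uniqueness clause of
`hLFU`, flatness of far members and compactness with convergence. -/
theorem helper_continuityOfLocalUnique (J : E4 → E4 →L[ℝ] E4) (R : ℝ) (P Q : E4 →L[ℝ] ℂ)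
    (eP eQ : ℂ →L[ℝ] E4)
    (hR : 0 < R) (hJs : ContDiff ℝ ∞ J) (hJ2 : ∀ x v, J x (J x v) = -v)
    (hPQ : IsCoordFrame P Q eP eQ)
    (hJP : ∀ x : E4, R ≤ ‖x‖ → ∀ v, P (J x v) = Complex.I * P v)
    (hJQ : ∀ x : E4, R ≤ ‖x‖ → ∀ v, Q (J x v) = Complex.I * Q v)
    (hLFU : ∀ (b₀ : ℂ) (u₀ : ℂ → E4), IsPencilMember J R P Q b₀ u₀ →
      ∃ ε > 0, ∃ Φ : ℂ → ℂ → E4,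
        ContDiffOn ℝ ∞ (fun p : ℂ × ℂ => Φ p.1 p.2) (Metric.ball b₀ ε ×ˢ univ) ∧ Φ b₀ = u₀ ∧
        (∀ b ∈ Metric.ball b₀ ε, IsPencilMember J R P Q b (Φ b)) ∧
        (∀ b ∈ Metric.ball b₀ ε, ∀ ξ β ζ : ℂ,
          fderiv ℝ (fun b' => Φ b' ξ) b β = fderiv ℝ (Φ b) ξ ζ → β = 0) ∧
        (∀ (b' : ℕ → ℂ) (w : ℕ → ℂ → E4), (∀ n, IsPencilMember J R P Q (b' n) (w n)) →
          Tendsto b' atTop (𝓝 b₀) → TendstoLocallyUniformly w u₀ atTop →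
          TendstoLocallyUniformly (fun n => fderiv ℝ (w n)) (fderiv ℝ u₀) atTop →
          ∀ᶠ n in atTop, w n = Φ (b' n)))
    (hEL : HasEmbeddedLimits J R P Q) :
    (∃ F : ℂ → ℂ → E4,
      ContDiff ℝ ∞ (fun p : ℂ × ℂ => F p.1 p.2) ∧
      Function.Bijective (fun p : ℂ × ℂ => F p.1 p.2) ∧
      (∀ p : ℂ × ℂ, Function.Bijective (fderiv ℝ (fun p : ℂ × ℂ => F p.1 p.2) p)) ∧
      (∀ b, IsPencilMember J R P Q b (F b)) ∧
      (∀ b : ℂ, 3 * R ≤ ‖b‖ → ∀ ξ, Q (F b ξ) = b) ∧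
      (∀ x : E4, 3 * R ≤ ‖Q x‖ → ∃ ξ, F (Q x) ξ = x)) ∨
    (∃ (K : Set E4) (f : ℕ → ℂ → E4), IsCompact K ∧ (∀ n, ContDiff ℝ ∞ (f n)) ∧
      (∀ n, IsJHolomorphicFlat J (f n)) ∧ (∀ n (z : ℂ), ‖z‖ ≤ 1 → f n z ∈ K) ∧
      Tendsto (fun n => ‖fderiv ℝ (f n) 0‖) atTop atTop) := by
  classical
  by_cases hblow : ∃ (K : Set E4) (f : ℕ → ℂ → E4), IsCompact K ∧ (∀ n, ContDiff ℝ ∞ (f n)) ∧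
      (∀ n, IsJHolomorphicFlat J (f n)) ∧ (∀ n (z : ℂ), ‖z‖ ≤ 1 → f n z ∈ K) ∧
      Tendsto (fun n => ‖fderiv ℝ (f n) 0‖) atTop atTop
  · exact Or.inr hblow
  -- far members are flat, hence unique over far values
  have hfarU : ∀ b : ℂ, R < ‖b‖ → ∀ u u' : ℂ → E4,
      IsPencilMember J R P Q b u → IsPencilMember J R P Q b u' → u = u' := by
    intro b hb u u' hu hu'
    rw [helper_farMemberFlat J R P Q eP eQ hR hPQ hJP hJQ b hb u hu,
      helper_farMemberFlat J R P Q eP eQ hR hPQ hJP hJQ b hb u' hu']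
  -- compactness with convergence (blow-up being excluded)
  have hcomp : ∀ (b : ℕ → ℂ) (u : ℕ → ℂ → E4) (bs : ℂ),
      (∀ n, IsPencilMember J R P Q (b n) (u n)) → (∀ n, ‖b n‖ < 2 * R) →
      Tendsto b atTop (𝓝 bs) →
      ∃ (v : ℂ → E4) (φ : ℕ → ℕ), StrictMono φ ∧ IsPencilMember J R P Q bs v ∧
        TendstoLocallyUniformly (fun k => u (φ k)) v atTop ∧
        TendstoLocallyUniformly (fun k => fderiv ℝ (u (φ k))) (fderiv ℝ v) atTop := by
    intro b u bs hm hb2 hbs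
    rcases helper_closedOrBlowupConv J R P Q eP eQ hR hJs hJ2 hPQ hJP hJQ hEL b u bs hm hb2 hbs
      with h | h
    · exact h
    · exact absurd h hblow
  -- uniqueness of members everywhere (clopen set of good values)
  have hU : ∀ (b : ℂ) (u u' : ℂ → E4), IsPencilMember J R P Q b u → IsPencilMember J R P Q b u' →
      u = u' := helper_uniqueOfLocalUnique J R P Q hR hLFU hfarU hcomp
  -- the local families (project out the uniqueness clause)
  have hLF : HasLocalFamilies J R P Q := by
    intro b₀ u₀ hu₀
    obtain ⟨ε, hε, Φ, hΦs, hΦ0, hΦm, hΦt, -⟩ := hLFU b₀ u₀ hu₀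
    exact ⟨ε, hε, Φ, hΦs, hΦ0, hΦm, hΦt⟩
  exact helper_continuityOfUniqueness J R P Q eP eQ hR hJs hJ2 hPQ hJP hJQ hLF hU hEL

end Summit.SmoothPoincare4.SmoothPoincare4.Cruxes.TameOrBrodyR4.Sketch
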